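import Summits.Ventures.PercRepro.C026AddEdge
import Summits.Ventures.PercRepro.C026DefectFlips

/-!
# mine-3's DC-SUB: the deletion–contraction identity of the C-026 slack (p5, gen 15)

mine-3 (`proofs/MINE3-FLIPS.md` §2, memo §23): `Δ_CF(H) = Δ_CF(H − e) + Δ_CF(H / e) − #DB(e)` for an edge
`e = uv` of `H` and `G = H − e`, with `Δ_CF(G) = #ab|c + #ac|b + #bc|a − #N_AB` (`slackCF`) and `DB(e)` the defect
set (`DCDefect`). With `H = G.addEdge u v` and `H / e = G.contract u v` (C026AddEdge, C026Contract):

* `dcDefect_iff` — through the bridges, `DB(e)` is exactly `{a ~ b in H / e but not in G} ∩ {the closed cluster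
  of c misses a, b in G but not in H / e}`;
* `indicator_identity` — the four-case bookkeeping `[A ∧ C] + [A' ∧ C'] + [D] = [A ∧ C'] + [A' ∧ C]`;
* **`slackCF_addEdge`** (DC-SUB) for every non-loop edge `e = uv` whose end `u` is not a mark;
* `not_dcDefect_of_parallel`, **`slackCF_addEdge_of_parallel`** — the parallel identity of mine-3's Theorem Y:
  `DB(e) = ∅` for an edge parallel to an edge of `G`, so `Δ_CF(G + uv) = Δ_CF(G) + Δ_CF(G / uv)`.
-/

namespace PercRepro

open Finset

namespace MultiGraph

section DCSub

variable {V E : Type*} (G : MultiGraph V E)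

open Classical in
/-- **mine-3's C-026 slack** `Δ_CF(G) = #ab|c + #ac|b + #bc|a − #N_AB`, with
`N_AB = {S : a ~_S b, c ≁_{S̄} a, c ≁_{S̄} b}`; the conjecture (CF) is `0 ≤ Δ_CF`. -/
noncomputable def slackCF [Fintype E] (a b c : V) : ℤ :=
  ((univ.filter fun ω : Config E => G.Conn ω a b ∧ ¬ G.Conn ω a c).card : ℤ) +
    ((univ.filter fun ω : Config E => G.Conn ω c a ∧ ¬ G.Conn ω c b).card : ℤ) +
    ((univ.filter fun ω : Config E => G.Conn ω c b ∧ ¬ G.Conn ω c a).card : ℤ) -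
    ((univ.filter fun ω : Config E =>
      G.Conn ω a b ∧ ¬ G.Conn ωᶜ c a ∧ ¬ G.Conn ωᶜ c b).card : ℤ)

variable {G}

/-- **`DB(e)` through the bridges**: `a ≁ b` in `G` but `a ~ b` in `H / e`, and the closed cluster of `c` misses
`a, b` in `G` but not in `H / e` (`v ≠ u`; marks `≠ u`). -/
theorem dcDefect_iff {u v : V} (huv : v ≠ u) {ω : Config E} {a b c : V} (ha : a ≠ u) (hb : b ≠ u)
    (hc : c ≠ u) :
    G.DCDefect ω a b c u v ↔
      ¬ G.Conn ω a b ∧ (G.contract u v).Conn ω a b ∧ (¬ G.Conn ωᶜ c a ∧ ¬ G.Conn ωᶜ c b) ∧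
        ¬ (¬ (G.contract u v).Conn ωᶜ c a ∧ ¬ (G.contract u v).Conn ωᶜ c b) := by
  rw [conn_contract_iff huv ha hb, conn_contract_iff huv hc ha, conn_contract_iff huv hc hb]
  unfold DCDefect
  constructor
  · rintro ⟨hab, hop, hca, hcb, hcl⟩
    refine ⟨hab, Or.inr ?_, ⟨hca, hcb⟩, ?_⟩
    · rcases hop with ⟨hau, hvb⟩ | ⟨hav, hub⟩
      · exact ⟨Or.inl hau, Or.inr hvb.symm⟩
      · exact ⟨Or.inr hav, Or.inl hub.symm⟩
    · intro hno
      rcases hcl with ⟨hcu, hva | hvb⟩ | ⟨hcv, hua | hub⟩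
      · exact hno.1 (Or.inr ⟨Or.inl hcu, Or.inr hva.symm⟩)
      · exact hno.2 (Or.inr ⟨Or.inl hcu, Or.inr hvb.symm⟩)
      · exact hno.1 (Or.inr ⟨Or.inr hcv, Or.inl hua.symm⟩)
      · exact hno.2 (Or.inr ⟨Or.inr hcv, Or.inl hub.symm⟩)
  · rintro ⟨hab, hab', ⟨hca, hcb⟩, hno⟩
    refine ⟨hab, ?_, hca, hcb, ?_⟩
    · rcases hab' with hab' | ⟨hau | hav, hbu | hbv⟩
      · exact absurd hab' hab
      · exact absurd (hau.trans hbu.symm) hab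
      · exact Or.inl ⟨hau, hbv.symm⟩
      · exact Or.inr ⟨hav, hbu.symm⟩
      · exact absurd (hav.trans hbv.symm) hab
    · by_contra hcl
      refine hno ⟨?_, ?_⟩
      · rintro (hca' | ⟨hcu | hcv, hau | hav⟩)
        · exact hca hca'
        · exact hca (hcu.trans hau.symm)
        · exact hcl (Or.inl ⟨hcu, Or.inl hav.symm⟩)
        · exact hcl (Or.inr ⟨hcv, Or.inl hau.symm⟩)
        · exact hca (hcv.trans hav.symm)
      · rintro (hcb' | ⟨hcu | hcv, hbu | hbv⟩)
        · exact hcb hcb'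
        · exact hcb (hcu.trans hbu.symm)
        · exact hcl (Or.inl ⟨hcu, Or.inr hbv.symm⟩)
        · exact hcl (Or.inr ⟨hcv, Or.inr hbu.symm⟩)
        · exact hcb (hcv.trans hbv.symm)

/-- The four-case bookkeeping behind DC-SUB: with `A → A'` and `C' → C`, the set where `A'` holds but not `A`
and `C` holds but not `C'` is exactly the defect of the split. -/
theorem indicator_identity {A A' C C' D : Prop} [Decidable A] [Decidable A'] [Decidable C]
    [Decidable C'] [Decidable D] (hAA : A → A') (hCC : C' → C) (hD : D ↔ ¬ A ∧ A' ∧ C ∧ ¬ C') :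
    (if A ∧ C then 1 else 0) + (if A' ∧ C' then 1 else 0) + (if D then 1 else 0) =
      (if A ∧ C' then 1 else 0) + (if A' ∧ C then 1 else 0) := by
  by_cases hA : A <;> by_cases hA' : A' <;> by_cases hC : C <;> by_cases hC' : C' <;>
    simp_all

open Classical in
/-- **DC-SUB (mine-3, memo §23)**: `Δ_CF(H) = Δ_CF(H − e) + Δ_CF(H / e) − #DB(e)` for an edge `e = uv` of `H`
that is not a loop and whose end `u` is not a mark (`H = G + e`, `H / e = G.contract u v`, `G = H − e`). -/
theorem slackCF_addEdge [Fintype E] {u v : V} (huv : v ≠ u) {a b c : V} (ha : a ≠ u) (hb : b ≠ u)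
    (hc : c ≠ u) :
    (G.addEdge u v).slackCF a b c =
      G.slackCF a b c + (G.contract u v).slackCF a b c -
        ((univ.filter fun ω : Config E => G.DCDefect ω a b c u v).card : ℤ) := by
  -- the three cells of `H` split into the cells of `G` and of `H / e`
  have h1 : (univ.filter fun τ : Config (Option E) =>
      (G.addEdge u v).Conn τ a b ∧ ¬ (G.addEdge u v).Conn τ a c).card =
      (univ.filter fun ω : Config E => G.Conn ω a b ∧ ¬ G.Conn ω a c).card +
        (univ.filter fun ω : Config E =>
          (G.contract u v).Conn ω a b ∧ ¬ (G.contract u v).Conn ω a c).card := by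
    rw [card_filter_option]
    simp only [conn_addEdge_closed_iff, conn_addEdge_open_iff_contract huv ha hb,
      conn_addEdge_open_iff_contract huv ha hc]
  have h2 : (univ.filter fun τ : Config (Option E) =>
      (G.addEdge u v).Conn τ c a ∧ ¬ (G.addEdge u v).Conn τ c b).card =
      (univ.filter fun ω : Config E => G.Conn ω c a ∧ ¬ G.Conn ω c b).card +
        (univ.filter fun ω : Config E =>
          (G.contract u v).Conn ω c a ∧ ¬ (G.contract u v).Conn ω c b).card := by
    rw [card_filter_option]
    simp only [conn_addEdge_closed_iff, conn_addEdge_open_iff_contract huv hc ha,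
      conn_addEdge_open_iff_contract huv hc hb]
  have h3 : (univ.filter fun τ : Config (Option E) =>
      (G.addEdge u v).Conn τ c b ∧ ¬ (G.addEdge u v).Conn τ c a).card =
      (univ.filter fun ω : Config E => G.Conn ω c b ∧ ¬ G.Conn ω c a).card +
        (univ.filter fun ω : Config E =>
          (G.contract u v).Conn ω c b ∧ ¬ (G.contract u v).Conn ω c a).card := by
    rw [card_filter_option]
    simp only [conn_addEdge_closed_iff, conn_addEdge_open_iff_contract huv hc ha,
      conn_addEdge_open_iff_contract huv hc hb]
  -- the `N_AB` count of `H` splits into the two mixed counts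
  have h4 : (univ.filter fun τ : Config (Option E) =>
      (G.addEdge u v).Conn τ a b ∧ ¬ (G.addEdge u v).Conn τᶜ c a ∧
        ¬ (G.addEdge u v).Conn τᶜ c b).card =
      (univ.filter fun ω : Config E => G.Conn ω a b ∧
        (¬ (G.contract u v).Conn ωᶜ c a ∧ ¬ (G.contract u v).Conn ωᶜ c b)).card +
        (univ.filter fun ω : Config E => (G.contract u v).Conn ω a b ∧
          (¬ G.Conn ωᶜ c a ∧ ¬ G.Conn ωᶜ c b)).card := by
    rw [card_filter_option]
    simp only [conn_addEdge_closed_iff, conn_addEdge_open_iff_contract huv ha hb,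
      conn_compl_addEdge_closed_iff huv hc ha, conn_compl_addEdge_closed_iff huv hc hb,
      conn_compl_addEdge_open_iff]
  -- the bookkeeping: `N_AB(G) + N_AB(H / e) + #DB(e) = the two mixed counts`
  have h5 : (univ.filter fun ω : Config E =>
      G.Conn ω a b ∧ (¬ G.Conn ωᶜ c a ∧ ¬ G.Conn ωᶜ c b)).card +
      (univ.filter fun ω : Config E => (G.contract u v).Conn ω a b ∧
        (¬ (G.contract u v).Conn ωᶜ c a ∧ ¬ (G.contract u v).Conn ωᶜ c b)).card +
      (univ.filter fun ω : Config E => G.DCDefect ω a b c u v).card =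
      (univ.filter fun ω : Config E => G.Conn ω a b ∧
        (¬ (G.contract u v).Conn ωᶜ c a ∧ ¬ (G.contract u v).Conn ωᶜ c b)).card +
        (univ.filter fun ω : Config E => (G.contract u v).Conn ω a b ∧
          (¬ G.Conn ωᶜ c a ∧ ¬ G.Conn ωᶜ c b)).card := by
    simp only [Finset.card_filter]
    rw [← Finset.sum_add_distrib, ← Finset.sum_add_distrib, ← Finset.sum_add_distrib]
    refine Finset.sum_congr rfl fun ω _ => ?_
    refine indicator_identity ?_ ?_ (dcDefect_iff huv ha hb hc)
    · exact conn_contract_of_conn_of_ne ha hb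
    · rintro ⟨hca, hcb⟩
      exact ⟨fun h => hca (conn_contract_of_conn_of_ne hc ha h),
        fun h => hcb (conn_contract_of_conn_of_ne hc hb h)⟩
  -- assemble in the ambient instances, then transport to the definition's (subsingleton instances)
  have key : ((univ.filter fun τ : Config (Option E) =>
        (G.addEdge u v).Conn τ a b ∧ ¬ (G.addEdge u v).Conn τ a c).card : ℤ) +
      ((univ.filter fun τ : Config (Option E) =>
        (G.addEdge u v).Conn τ c a ∧ ¬ (G.addEdge u v).Conn τ c b).card : ℤ) +
      ((univ.filter fun τ : Config (Option E) =>
        (G.addEdge u v).Conn τ c b ∧ ¬ (G.addEdge u v).Conn τ c a).card : ℤ) -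
      ((univ.filter fun τ : Config (Option E) =>
        (G.addEdge u v).Conn τ a b ∧ ¬ (G.addEdge u v).Conn τᶜ c a ∧
          ¬ (G.addEdge u v).Conn τᶜ c b).card : ℤ) =
      ((univ.filter fun ω : Config E => G.Conn ω a b ∧ ¬ G.Conn ω a c).card : ℤ) +
        ((univ.filter fun ω : Config E => G.Conn ω c a ∧ ¬ G.Conn ω c b).card : ℤ) +
        ((univ.filter fun ω : Config E => G.Conn ω c b ∧ ¬ G.Conn ω c a).card : ℤ) -
        ((univ.filter fun ω : Config E =>
          G.Conn ω a b ∧ ¬ G.Conn ωᶜ c a ∧ ¬ G.Conn ωᶜ c b).card : ℤ) +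
      (((univ.filter fun ω : Config E =>
          (G.contract u v).Conn ω a b ∧ ¬ (G.contract u v).Conn ω a c).card : ℤ) +
        ((univ.filter fun ω : Config E =>
          (G.contract u v).Conn ω c a ∧ ¬ (G.contract u v).Conn ω c b).card : ℤ) +
        ((univ.filter fun ω : Config E =>
          (G.contract u v).Conn ω c b ∧ ¬ (G.contract u v).Conn ω c a).card : ℤ) -
        ((univ.filter fun ω : Config E => (G.contract u v).Conn ω a b ∧
          ¬ (G.contract u v).Conn ωᶜ c a ∧ ¬ (G.contract u v).Conn ωᶜ c b).card : ℤ)) -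
      ((univ.filter fun ω : Config E => G.DCDefect ω a b c u v).card : ℤ) := by
    rw [h1, h2, h3, h4]
    push_cast
    omega
  unfold slackCF
  convert key using 8

/-- **`DB(e)` is empty for an edge parallel to an edge of `G`**: an open copy joins `u` to `v` (so `a ~ b`), a closed
copy joins them in `S̄` (so the closed cluster of `c` reaches a mark). -/
theorem not_dcDefect_of_parallel {ω : Config E} {a b c u v : V} {f : E}
    (hf : (G.fst f = u ∧ G.snd f = v) ∨ (G.fst f = v ∧ G.snd f = u)) :
    ¬ G.DCDefect ω a b c u v := by
  rintro ⟨hab, hop, hca, hcb, hcl⟩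
  by_cases hfo : ω f = true
  · -- `u ~ v`: `a ~ b` through the copy
    have huv : G.Conn ω u v := Conn.of_openAdj ⟨f, hfo, hf⟩
    rcases hop with ⟨hau, hvb⟩ | ⟨hav, hub⟩
    · exact hab ((hau.trans huv).trans hvb)
    · exact hab ((hav.trans huv.symm).trans hub)
  · -- `u ~ v` in `S̄`: `c` reaches a mark in `S̄`
    have hfc : ωᶜ f = true := by
      rw [compl_apply_not]
      simpa using hfo
    have huv : G.Conn ωᶜ u v := Conn.of_openAdj ⟨f, hfc, hf⟩
    rcases hcl with ⟨hcu, hva | hvb⟩ | ⟨hcv, hua | hub⟩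
    · exact hca ((hcu.trans huv).trans hva)
    · exact hcb ((hcu.trans huv).trans hvb)
    · exact hca ((hcv.trans huv.symm).trans hua)
    · exact hcb ((hcv.trans huv.symm).trans hub)

open Classical in
/-- **The parallel identity of mine-3's Theorem Y** (memo §29 add., (Y) for a parallel copy): adding an edge
parallel to an edge `f = uv` of `G` gives `Δ_CF(G + uv) = Δ_CF(G) + Δ_CF(G / uv)` (`v ≠ u`, marks `≠ u`). -/
theorem slackCF_addEdge_of_parallel [Fintype E] {u v : V} (huv : v ≠ u) {a b c : V} (ha : a ≠ u)
    (hb : b ≠ u) (hc : c ≠ u) {f : E}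
    (hf : (G.fst f = u ∧ G.snd f = v) ∨ (G.fst f = v ∧ G.snd f = u)) :
    (G.addEdge u v).slackCF a b c = G.slackCF a b c + (G.contract u v).slackCF a b c := by
  rw [slackCF_addEdge huv ha hb hc]
  have h : (univ.filter fun ω : Config E => G.DCDefect ω a b c u v) = ∅ := by
    rw [Finset.filter_eq_empty_iff]
    intro ω _
    exact not_dcDefect_of_parallel hf
  rw [h, Finset.card_empty]
  push_cast
  ring

end DCSub

end MultiGraph

end PercRepro
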